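import Mathlib
import Summits.AtomisticToContinuum.FouriersLaw.Theorems.EmbeddedDrudeMourreDrudeDissolutionResonanceStructure
import Summits.AtomisticToContinuum.FouriersLaw.Theorems.EmbeddedDrudeMourreDrudeDissolutionStubExcursionSecondDifferencePlaneSheetFibre
import Summits.AtomisticToContinuum.FouriersLaw.Theorems.EmbeddedDrudeMourreDrudeDissolutionStubExcursionSecondDifferencePlaneSheetTransversal
import HarnessLib

/-!
# Transversality of the sheet amplitude `A` along the critical curves of `Ω = −A·S₁·S₂`
(crux `EmbeddedDrudeMourre.DrudeDissolution`, item stmt-AtomisticToContinuum-12593; `--supports` file for the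
registered sub-goal `sheet_transversality` of stub B1b″ `stub_excursionSecondDifference` of line
`kinetic-polymer-gas-on-the-time-axis`; closes nothing; lead c13 (process B), 2026-08-17)

WHAT. With `S₁ = sin((k₃−k₁)/2)`, `S₂ = sin((k₃−k₂)/2)`, `A = 8H/Q` read at `p = (k₁,(k₃,k₂))`
(`resonance_product_structure`), the three transversality facts the local Morse–Bott floors need:
* `sheet_transversal₁`: on the exchange plane `S₁ = 0`, at a zero of `A`, `∂A/∂k₂ ≠ 0`
  (there `H` restricts to the plane sheet function `H₀(k₁,k₂)` of `sheetFn_plane_identity`, and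
  `sheetFn_plane_deriv_snd_ne_zero` applies);
* `sheet_transversal₂`: on `S₂ = 0`, at a zero of `A`, `∂A/∂k₁ ≠ 0` (same, with the symmetric `H₀(k₂,k₁)`);
* `sheet_transversal_diag`: on the diagonal `S₁ = S₂ = 0`, at a zero of `A` (a triple point),
  `(∂₁+∂₂+∂₃)A ≠ 0` (there `H` restricts to `±(2(ω²+ω₂+2)cos − 4)` along the diagonal,
  `sheetFn_diag_hasDerivAt`, and `4 sin k (2cos k − ω₂ − 2) ≠ 0` at its zeros).
Method: along the relevant line `t ↦ γ(t)` one has `A(γ t)·Q(γ t) = 8·H_line(t)` identically; differentiate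
the product at the zero of `A` (`hasDerivAt_ne_zero_of_mul_eq`). `sheet_transversality` (registered) packages the three.

WHY (role). Inputs `α ≠ 0`, `β ≠ 0` of `floorLocal_curve` / `floorLocal_triple` in item (C4) (gradient floor)
of the remaining concrete work for B1b″.
-/

noncomputable section

open scoped Topology
open Filter

namespace Summit.AtomisticToContinuum.FouriersLaw.Theorems.DrudeDissolution.KineticPolymerGasOnTheTimeAxis

open Literature.MathematicalPhysics.KineticTheory
open Literature.MathematicalPhysics.KineticTheory.PhononBoltzmann

/-! ### Small tools -/

/-- `cos(nπ)·cos(x − nπ) = cos x` (`n ∈ ℤ`). [folklore] -/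
theorem cos_int_mul_pi_mul_cos_sub (x : ℝ) (n : ℤ) :
    Real.cos (n * Real.pi) * Real.cos (x - n * Real.pi) = Real.cos x := by
  have hs : Real.sin (n * Real.pi) = 0 := Real.sin_int_mul_pi n
  have hc : Real.cos (n * Real.pi) ^ 2 = 1 := by
    have := Real.sin_sq_add_cos_sq (n * Real.pi); rw [hs] at this; linarith
  rw [Real.cos_sub, hs, mul_zero, add_zero]
  linear_combination Real.cos x * hc

/-- `cos(nπ)·cos(x + nπ) = cos x` (`n ∈ ℤ`). [folklore] -/
theorem cos_int_mul_pi_mul_cos_add (x : ℝ) (n : ℤ) :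
    Real.cos (n * Real.pi) * Real.cos (x + n * Real.pi) = Real.cos x := by
  have := cos_int_mul_pi_mul_cos_sub x (-n)
  simp only [Int.cast_neg, neg_mul, Real.cos_neg, sub_neg_eq_add] at this
  exact this

/-- `cos(nπ)·cos(mπ) = cos((n−m)π)` and it squares to `1`. [folklore] -/
theorem cos_int_mul_pi_mul_cos_int_mul_pi (n m : ℤ) :
    Real.cos (n * Real.pi) * Real.cos (m * Real.pi) = Real.cos ((n - m : ℤ) * Real.pi) ∧
      (Real.cos (n * Real.pi) * Real.cos (m * Real.pi)) ^ 2 = 1 := by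
  have hsn : Real.sin (n * Real.pi) = 0 := Real.sin_int_mul_pi n
  have hsm : Real.sin (m * Real.pi) = 0 := Real.sin_int_mul_pi m
  have hcn : Real.cos (n * Real.pi) ^ 2 = 1 := by
    have := Real.sin_sq_add_cos_sq (n * Real.pi); rw [hsn] at this; linarith
  have hcm : Real.cos (m * Real.pi) ^ 2 = 1 := by
    have := Real.sin_sq_add_cos_sq (m * Real.pi); rw [hsm] at this; linarith
  refine ⟨?_, ?_⟩
  · rw [Int.cast_sub, sub_mul, Real.cos_sub, hsn, hsm]; ring
  · rw [mul_pow, hcn, hcm, one_mul]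

/-- **Differentiating a product at a zero.** If `f·g = h` identically, `f(t₀) = 0` and `h′(t₀) ≠ 0`, then
`f′(t₀) ≠ 0` (indeed `f′(t₀)·g(t₀) = h′(t₀)`). [folklore] -/
theorem hasDerivAt_ne_zero_of_mul_eq {f g h : ℝ → ℝ} {a b e t₀ : ℝ} (hf : HasDerivAt f a t₀)
    (hg : HasDerivAt g b t₀) (hh : HasDerivAt h e t₀) (hfg : ∀ t, f t * g t = h t) (hf0 : f t₀ = 0)
    (he : e ≠ 0) : a ≠ 0 := by
  have hprod : HasDerivAt (fun t => f t * g t) (a * g t₀ + f t₀ * b) t₀ := hf.mul hg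
  have hfun : (fun t => f t * g t) = h := funext hfg
  rw [hfun] at hprod
  have huniq := hprod.unique hh
  rw [hf0, zero_mul, add_zero] at huniq
  intro ha
  rw [ha, zero_mul] at huniq
  exact he huniq.symm

/-! ### The three transversality facts -/

section Structure

variable {ω₂ : ℝ} (hω : 0 < ω₂) {A S₁ S₂ : ℝ × ℝ × ℝ → ℝ}
  (hS₁ : ∀ p : ℝ × ℝ × ℝ, S₁ p = Real.sin ((p.2.1 - p.1) / 2))
  (hS₂ : ∀ p : ℝ × ℝ × ℝ, S₂ p = Real.sin ((p.2.1 - p.2.2) / 2))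
  (hA : ∀ p : ℝ × ℝ × ℝ, A p =
    8 * ((dispersion ω₂ p.1 * dispersion ω₂ p.2.2 +
            dispersion ω₂ p.2.1 * dispersion ω₂ (p.1 + p.2.2 - p.2.1) + 2 * (ω₂ + 2)) *
          Real.cos ((p.1 + p.2.2) / 2) -
        4 * Real.cos ((p.2.1 - p.1) / 2) * Real.cos ((p.2.2 - p.2.1) / 2)) /
      ((dispersion ω₂ p.1 + dispersion ω₂ p.2.2 + dispersion ω₂ p.2.1 + dispersion ω₂ (p.1 + p.2.2 - p.2.1)) *
        (dispersion ω₂ p.1 * dispersion ω₂ p.2.2 + dispersion ω₂ p.2.1 * dispersion ω₂ (p.1 + p.2.2 - p.2.1))))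

include hω hA in
/-- `A·Q = 8H` pointwise. [folklore] -/
theorem resonance_A_mul_Q (p : ℝ × ℝ × ℝ) :
    A p * ((dispersion ω₂ p.1 + dispersion ω₂ p.2.2 + dispersion ω₂ p.2.1 + dispersion ω₂ (p.1 + p.2.2 - p.2.1)) *
        (dispersion ω₂ p.1 * dispersion ω₂ p.2.2 + dispersion ω₂ p.2.1 * dispersion ω₂ (p.1 + p.2.2 - p.2.1))) =
      8 * ((dispersion ω₂ p.1 * dispersion ω₂ p.2.2 +
            dispersion ω₂ p.2.1 * dispersion ω₂ (p.1 + p.2.2 - p.2.1) + 2 * (ω₂ + 2)) *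
          Real.cos ((p.1 + p.2.2) / 2) -
        4 * Real.cos ((p.2.1 - p.1) / 2) * Real.cos ((p.2.2 - p.2.1) / 2)) := by
  rw [hA, div_mul_cancel₀ _ (resonance_Q_pos hω p).ne']

include hω hS₁ hA in
/-- **Transversality on the first exchange plane.** At `p₀ = (k₁,(k₃,k₂))` with `S₁(p₀) = 0` (i.e.
`k₃ ≡ k₁ (2π)`) and `A(p₀) = 0`: `∂A/∂k₂ (p₀) = DA(p₀)(0,0,1) ≠ 0`. [folklore] -/
theorem sheet_transversal₁ (k₁ k₃ k₂ : ℝ) (h1 : S₁ (k₁, k₃, k₂) = 0) (h0 : A (k₁, k₃, k₂) = 0) :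
    fderiv ℝ A (k₁, k₃, k₂) (0, 0, 1) ≠ 0 := by
  -- `k₃ = k₁ + n·2π`
  rw [hS₁] at h1
  obtain ⟨n, hn⟩ := Real.sin_eq_zero_iff.1 h1
  simp only at hn
  have hk : k₃ = k₁ + n * (2 * Real.pi) := by linarith
  have hper := dispersion_periodic ω₂
  have hdd : Differentiable ℝ (dispersion ω₂) := fun k => (hasDerivAt_dispersion hω k).differentiableAt
  -- the line `t ↦ (k₁,(k₃,t))`
  have hline : HasDerivAt (fun t : ℝ => ((k₁, k₃, t) : ℝ × ℝ × ℝ)) ((0 : ℝ), (0 : ℝ), (1 : ℝ)) k₂ :=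
    (hasDerivAt_const k₂ k₁).prodMk ((hasDerivAt_const k₂ k₃).prodMk (hasDerivAt_id k₂))
  have hAd : DifferentiableAt ℝ A (k₁, k₃, k₂) := ((resonance_contDiff_A hω hA 1).differentiable one_ne_zero) _
  have hf : HasDerivAt (fun t : ℝ => A (k₁, k₃, t)) (fderiv ℝ A (k₁, k₃, k₂) (0, 0, 1)) k₂ :=
    hAd.hasFDerivAt.comp_hasDerivAt k₂ hline
  -- the normalising factor along the line
  set g : ℝ → ℝ := fun t => (dispersion ω₂ k₁ + dispersion ω₂ t + dispersion ω₂ k₃ + dispersion ω₂ (k₁ + t - k₃)) *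
    (dispersion ω₂ k₁ * dispersion ω₂ t + dispersion ω₂ k₃ * dispersion ω₂ (k₁ + t - k₃)) with hgdef
  have hgd : DifferentiableAt ℝ g k₂ := by rw [hgdef]; fun_prop
  have hg : HasDerivAt g (deriv g k₂) k₂ := hgd.hasDerivAt
  -- the plane sheet function along the line
  have hh := (sheetFn_plane_hasDerivAt_snd ω₂ hω k₁ k₂).const_mul 8
  -- the identity `A(γ t)·Q(γ t) = 8 H₀(k₁,t)`
  have hω3 : dispersion ω₂ k₃ = dispersion ω₂ k₁ := by rw [hk]; exact hper.int_mul n k₁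
  have hω4 : ∀ t, dispersion ω₂ (k₁ + t - k₃) = dispersion ω₂ t := fun t => by
    rw [hk, show k₁ + t - (k₁ + n * (2 * Real.pi)) = t - n * (2 * Real.pi) by ring]
    exact hper.sub_int_mul_eq n
  have hcos : ∀ t, 4 * Real.cos ((k₃ - k₁) / 2) * Real.cos ((t - k₃) / 2) = 4 * Real.cos ((k₁ - t) / 2) := by
    intro t
    rw [hk, show (k₁ + n * (2 * Real.pi) - k₁) / 2 = n * Real.pi by ring,
      show (t - (k₁ + n * (2 * Real.pi))) / 2 = (t - k₁) / 2 - n * Real.pi by ring, mul_assoc,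
      cos_int_mul_pi_mul_cos_sub, ← Real.cos_neg, show -((t - k₁) / 2) = (k₁ - t) / 2 by ring]
  have hfg : ∀ t, A (k₁, k₃, t) * g t =
      8 * (2 * (dispersion ω₂ k₁ * dispersion ω₂ t + ω₂ + 2) * Real.cos ((k₁ + t) / 2) -
        4 * Real.cos ((k₁ - t) / 2)) := by
    intro t
    have h := resonance_A_mul_Q hω hA (k₁, k₃, t)
    simp only at h
    rw [hgdef]
    simp only
    rw [h, ← hcos t, hω3, hω4 t]
    ring
  have hf0 : (fun t : ℝ => A (k₁, k₃, t)) k₂ = 0 := h0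
  -- `H₀(k₁,k₂) = 0`, so the fibre derivative is non-zero
  have hH0 : 2 * (dispersion ω₂ k₁ * dispersion ω₂ k₂ + ω₂ + 2) * Real.cos ((k₁ + k₂) / 2) -
      4 * Real.cos ((k₁ - k₂) / 2) = 0 := by
    have := hfg k₂; rw [h0, zero_mul] at this; linarith
  have hE := sheetFn_plane_deriv_snd_ne_zero ω₂ hω k₁ k₂ hH0
  exact hasDerivAt_ne_zero_of_mul_eq hf hg hh hfg hf0 (mul_ne_zero (by norm_num) hE)

include hω hS₂ hA in
/-- **Transversality on the second exchange plane.** At `p₀ = (k₁,(k₃,k₂))` with `S₂(p₀) = 0` (i.e.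
`k₃ ≡ k₂ (2π)`) and `A(p₀) = 0`: `∂A/∂k₁ (p₀) = DA(p₀)(1,0,0) ≠ 0`. [folklore] -/
theorem sheet_transversal₂ (k₁ k₃ k₂ : ℝ) (h2 : S₂ (k₁, k₃, k₂) = 0) (h0 : A (k₁, k₃, k₂) = 0) :
    fderiv ℝ A (k₁, k₃, k₂) (1, 0, 0) ≠ 0 := by
  rw [hS₂] at h2
  obtain ⟨n, hn⟩ := Real.sin_eq_zero_iff.1 h2
  simp only at hn
  have hk : k₃ = k₂ + n * (2 * Real.pi) := by linarith
  have hper := dispersion_periodic ω₂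
  have hdd : Differentiable ℝ (dispersion ω₂) := fun k => (hasDerivAt_dispersion hω k).differentiableAt
  have hline : HasDerivAt (fun t : ℝ => ((t, k₃, k₂) : ℝ × ℝ × ℝ)) ((1 : ℝ), (0 : ℝ), (0 : ℝ)) k₁ :=
    (hasDerivAt_id k₁).prodMk ((hasDerivAt_const k₁ k₃).prodMk (hasDerivAt_const k₁ k₂))
  have hAd : DifferentiableAt ℝ A (k₁, k₃, k₂) := ((resonance_contDiff_A hω hA 1).differentiable one_ne_zero) _
  have hf : HasDerivAt (fun t : ℝ => A (t, k₃, k₂)) (fderiv ℝ A (k₁, k₃, k₂) (1, 0, 0)) k₁ :=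
    hAd.hasFDerivAt.comp_hasDerivAt k₁ hline
  set g : ℝ → ℝ := fun t => (dispersion ω₂ t + dispersion ω₂ k₂ + dispersion ω₂ k₃ + dispersion ω₂ (t + k₂ - k₃)) *
    (dispersion ω₂ t * dispersion ω₂ k₂ + dispersion ω₂ k₃ * dispersion ω₂ (t + k₂ - k₃)) with hgdef
  have hgd : DifferentiableAt ℝ g k₁ := by rw [hgdef]; fun_prop
  have hg : HasDerivAt g (deriv g k₁) k₁ := hgd.hasDerivAt
  -- the (symmetric) plane sheet function `t ↦ H₀(k₂, t)` at `t = k₁`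
  have hh := (sheetFn_plane_hasDerivAt_snd ω₂ hω k₂ k₁).const_mul 8
  have hω3 : dispersion ω₂ k₃ = dispersion ω₂ k₂ := by rw [hk]; exact hper.int_mul n k₂
  have hω4 : ∀ t, dispersion ω₂ (t + k₂ - k₃) = dispersion ω₂ t := fun t => by
    rw [hk, show t + k₂ - (k₂ + n * (2 * Real.pi)) = t - n * (2 * Real.pi) by ring]
    exact hper.sub_int_mul_eq n
  have hcos : ∀ t, 4 * Real.cos ((k₃ - t) / 2) * Real.cos ((k₂ - k₃) / 2) = 4 * Real.cos ((k₂ - t) / 2) := by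
    intro t
    rw [hk, show (k₂ - (k₂ + n * (2 * Real.pi))) / 2 = -(n * Real.pi) by ring, Real.cos_neg,
      show (k₂ + n * (2 * Real.pi) - t) / 2 = (k₂ - t) / 2 + n * Real.pi by ring, mul_assoc, mul_comm (Real.cos _),
      cos_int_mul_pi_mul_cos_add]
  have hfg : ∀ t, A (t, k₃, k₂) * g t =
      8 * (2 * (dispersion ω₂ k₂ * dispersion ω₂ t + ω₂ + 2) * Real.cos ((k₂ + t) / 2) -
        4 * Real.cos ((k₂ - t) / 2)) := by
    intro t
    have h := resonance_A_mul_Q hω hA (t, k₃, k₂)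
    simp only at h
    rw [hgdef]
    simp only
    rw [h, ← hcos t, hω3, hω4 t, show (t + k₂) / 2 = (k₂ + t) / 2 by ring]
    ring
  have hf0 : (fun t : ℝ => A (t, k₃, k₂)) k₁ = 0 := h0
  have hH0 : 2 * (dispersion ω₂ k₂ * dispersion ω₂ k₁ + ω₂ + 2) * Real.cos ((k₂ + k₁) / 2) -
      4 * Real.cos ((k₂ - k₁) / 2) = 0 := by
    have := hfg k₁; rw [h0, zero_mul] at this; linarith
  have hE := sheetFn_plane_deriv_snd_ne_zero ω₂ hω k₂ k₁ hH0
  exact hasDerivAt_ne_zero_of_mul_eq hf hg hh hfg hf0 (mul_ne_zero (by norm_num) hE)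

include hω hS₁ hS₂ hA in
/-- **Transversality of the sheet to the diagonal at the triple points.** At `p₀ = (k₁,(k₃,k₂))` with `S₁(p₀) = S₂(p₀) = 0` (the diagonal, mod `2π`) and
`A(p₀) = 0`: `(∂₁ + ∂₂ + ∂₃)A(p₀) ≠ 0`. [folklore] -/
theorem sheet_transversal_diag (k₁ k₃ k₂ : ℝ) (h1 : S₁ (k₁, k₃, k₂) = 0) (h2 : S₂ (k₁, k₃, k₂) = 0)
    (h0 : A (k₁, k₃, k₂) = 0) :
    fderiv ℝ A (k₁, k₃, k₂) (1, 0, 0) + fderiv ℝ A (k₁, k₃, k₂) (0, 1, 0) + fderiv ℝ A (k₁, k₃, k₂) (0, 0, 1) ≠ 0 := by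
  rw [hS₁] at h1
  rw [hS₂] at h2
  obtain ⟨n, hn⟩ := Real.sin_eq_zero_iff.1 h1
  obtain ⟨m, hm⟩ := Real.sin_eq_zero_iff.1 h2
  simp only at hn hm
  have hk3 : k₃ = k₁ + n * (2 * Real.pi) := by linarith
  have hk2 : k₂ = k₁ + n * (2 * Real.pi) - m * (2 * Real.pi) := by linarith
  have hper := dispersion_periodic ω₂
  have hdd : Differentiable ℝ (dispersion ω₂) := fun k => (hasDerivAt_dispersion hω k).differentiableAt
  -- the diagonal line through `p₀`
  have hline : HasDerivAt (fun t : ℝ => ((k₁ + t, k₃ + t, k₂ + t) : ℝ × ℝ × ℝ)) ((1 : ℝ), (1 : ℝ), (1 : ℝ)) 0 :=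
    ((hasDerivAt_id (0 : ℝ)).const_add k₁).prodMk
      (((hasDerivAt_id (0 : ℝ)).const_add k₃).prodMk ((hasDerivAt_id (0 : ℝ)).const_add k₂))
  have hAdiff : Differentiable ℝ A := (resonance_contDiff_A hω hA 1).differentiable one_ne_zero
  have hf' : HasDerivAt (fun t : ℝ => A (k₁ + t, k₃ + t, k₂ + t))
      (fderiv ℝ A (k₁ + 0, k₃ + 0, k₂ + 0) (1, 1, 1)) 0 :=
    (hAdiff _).hasFDerivAt.comp_hasDerivAt (0 : ℝ) hline
  simp only [add_zero] at hf'
  have hsum : fderiv ℝ A (k₁, k₃, k₂) (1, 1, 1) =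
      fderiv ℝ A (k₁, k₃, k₂) (1, 0, 0) + fderiv ℝ A (k₁, k₃, k₂) (0, 1, 0) + fderiv ℝ A (k₁, k₃, k₂) (0, 0, 1) := by
    rw [← map_add, ← map_add]
    congr 1
    simp only [Prod.mk_add_mk, add_zero, zero_add]
  rw [hsum] at hf'
  -- the normalising factor along the line
  set g : ℝ → ℝ := fun t =>
    (dispersion ω₂ (k₁ + t) + dispersion ω₂ (k₂ + t) + dispersion ω₂ (k₃ + t) +
        dispersion ω₂ (k₁ + t + (k₂ + t) - (k₃ + t))) *
      (dispersion ω₂ (k₁ + t) * dispersion ω₂ (k₂ + t) +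
        dispersion ω₂ (k₃ + t) * dispersion ω₂ (k₁ + t + (k₂ + t) - (k₃ + t))) with hgdef
  have hgd : DifferentiableAt ℝ g 0 := by rw [hgdef]; fun_prop
  have hg : HasDerivAt g (deriv g 0) 0 := hgd.hasDerivAt
  -- the sign `ε = cos(nπ)cos(mπ)` and the diagonal sheet function
  set ε : ℝ := Real.cos (n * Real.pi) * Real.cos (m * Real.pi) with hεdef
  obtain ⟨hεnm, hε2⟩ := cos_int_mul_pi_mul_cos_int_mul_pi n m
  have hε0 : ε ≠ 0 := by
    intro h
    have : ε ^ 2 = 1 := hε2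
    rw [h] at this
    norm_num at this
  have hh := ((sheetFn_diag_hasDerivAt hω.le k₁).const_mul ε).const_mul 8
  -- the identity `A(γ t)·Q(γ t) = 8 ε H_diag(t)`
  have hωa : ∀ t, dispersion ω₂ (k₂ + t) = dispersion ω₂ (k₁ + t) := fun t => by
    rw [hk2, show k₁ + n * (2 * Real.pi) - m * (2 * Real.pi) + t = (k₁ + t) + n * (2 * Real.pi) - m * (2 * Real.pi)
      by ring, hper.sub_int_mul_eq m, hper.int_mul n]
  have hωb : ∀ t, dispersion ω₂ (k₃ + t) = dispersion ω₂ (k₁ + t) := fun t => by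
    rw [hk3, show k₁ + n * (2 * Real.pi) + t = (k₁ + t) + n * (2 * Real.pi) by ring, hper.int_mul n]
  have hωc : ∀ t, dispersion ω₂ (k₁ + t + (k₂ + t) - (k₃ + t)) = dispersion ω₂ (k₁ + t) := fun t => by
    rw [hk2, hk3, show k₁ + t + (k₁ + n * (2 * Real.pi) - m * (2 * Real.pi) + t) - (k₁ + n * (2 * Real.pi) + t) =
      (k₁ + t) - m * (2 * Real.pi) by ring, hper.sub_int_mul_eq m]
  have hcos1 : ∀ t, Real.cos ((k₁ + t + (k₂ + t)) / 2) = ε * Real.cos (k₁ + t) := fun t => by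
    rw [hk2, show (k₁ + t + (k₁ + n * (2 * Real.pi) - m * (2 * Real.pi) + t)) / 2 =
      (k₁ + t) + ((n - m : ℤ) : ℝ) * Real.pi by push_cast; ring, Real.cos_add, Real.sin_int_mul_pi, mul_zero,
      sub_zero, hεdef, hεnm, mul_comm]
  have hcos2 : ∀ t : ℝ, 4 * Real.cos ((k₃ + t - (k₁ + t)) / 2) * Real.cos ((k₂ + t - (k₃ + t)) / 2) = 4 * ε := by
    intro t
    rw [hk2, hk3, show (k₁ + n * (2 * Real.pi) + t - (k₁ + t)) / 2 = n * Real.pi by ring,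
      show (k₁ + n * (2 * Real.pi) - m * (2 * Real.pi) + t - (k₁ + n * (2 * Real.pi) + t)) / 2 = -(m * Real.pi)
      by ring, Real.cos_neg, hεdef, mul_assoc]
  have hfg : ∀ t, A (k₁ + t, k₃ + t, k₂ + t) * g t =
      8 * (ε * (2 * (dispersion ω₂ (k₁ + t) ^ 2 + ω₂ + 2) * Real.cos (k₁ + t) - 4)) := by
    intro t
    have h := resonance_A_mul_Q hω hA (k₁ + t, k₃ + t, k₂ + t)
    simp only at h
    rw [hgdef]
    simp only
    rw [h, hcos1 t, hcos2 t, hωa t, hωb t, hωc t]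
    ring
  have hf0 : (fun t : ℝ => A (k₁ + t, k₃ + t, k₂ + t)) 0 = 0 := by simp only [add_zero]; exact h0
  -- the diagonal sheet function vanishes at `t = 0`, hence its derivative does not
  have hH0 : 2 * (dispersion ω₂ k₁ ^ 2 + ω₂ + 2) * Real.cos k₁ - 4 = 0 := by
    have := hfg 0
    simp only [add_zero] at this
    rw [h0, zero_mul] at this
    have h8 : 8 * ε ≠ 0 := mul_ne_zero (by norm_num) hε0
    have : 8 * ε * (2 * (dispersion ω₂ k₁ ^ 2 + ω₂ + 2) * Real.cos k₁ - 4) = 0 := by linarith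
    exact (mul_eq_zero.1 this).resolve_left h8
  rw [dispersion_sq hω.le] at hH0
  have hcos_le := Real.cos_le_one k₁
  have hsin : Real.sin k₁ ≠ 0 := by
    intro hs
    have hc2 : Real.cos k₁ ^ 2 = 1 := by have := Real.sin_sq_add_cos_sq k₁; rw [hs] at this; linarith
    have hc : Real.cos k₁ = 1 ∨ Real.cos k₁ = -1 := by
      have : (Real.cos k₁ - 1) * (Real.cos k₁ + 1) = 0 := by linear_combination hc2
      rcases mul_eq_zero.1 this with h | h
      · exact Or.inl (by linarith)
      · exact Or.inr (by linarith)
    rcases hc with hc | hc <;> rw [hc] at hH0 <;> nlinarith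
  have hlin : 2 * Real.cos k₁ - ω₂ - 2 ≠ 0 := by intro h; linarith
  have hE : 8 * (ε * (4 * Real.sin k₁ * (2 * Real.cos k₁ - ω₂ - 2))) ≠ 0 :=
    mul_ne_zero (by norm_num) (mul_ne_zero hε0 (mul_ne_zero (mul_ne_zero (by norm_num) hsin) hlin))
  exact hasDerivAt_ne_zero_of_mul_eq hf' hg hh hfg hf0 hE

end Structure

/-- **Registered sub-goal `sheet_transversality` of stub B1b″ (packaging of the three facts).** For `ω₂ > 0`
and `S₁, S₂, A` as in `resonance_product_structure`, at every `p₀ = (k₁,(k₃,k₂))`: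
`S₁ = 0 ∧ A = 0 ⇒ ∂A/∂k₂ ≠ 0`, `S₂ = 0 ∧ A = 0 ⇒ ∂A/∂k₁ ≠ 0`, `S₁ = S₂ = 0 ∧ A = 0 ⇒ (∂₁+∂₂+∂₃)A ≠ 0`.
[folklore] -/
theorem sheet_transversality :
    ∀ ω₂ : ℝ, 0 < ω₂ → ∀ (A S₁ S₂ : ℝ × ℝ × ℝ → ℝ),
      (∀ p : ℝ × ℝ × ℝ, S₁ p = Real.sin ((p.2.1 - p.1) / 2)) →
      (∀ p : ℝ × ℝ × ℝ, S₂ p = Real.sin ((p.2.1 - p.2.2) / 2)) →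
      (∀ p : ℝ × ℝ × ℝ, A p =
        8 * ((dispersion ω₂ p.1 * dispersion ω₂ p.2.2 +
                dispersion ω₂ p.2.1 * dispersion ω₂ (p.1 + p.2.2 - p.2.1) + 2 * (ω₂ + 2)) *
              Real.cos ((p.1 + p.2.2) / 2) -
            4 * Real.cos ((p.2.1 - p.1) / 2) * Real.cos ((p.2.2 - p.2.1) / 2)) /
          ((dispersion ω₂ p.1 + dispersion ω₂ p.2.2 + dispersion ω₂ p.2.1 + dispersion ω₂ (p.1 + p.2.2 - p.2.1)) *
            (dispersion ω₂ p.1 * dispersion ω₂ p.2.2 +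
              dispersion ω₂ p.2.1 * dispersion ω₂ (p.1 + p.2.2 - p.2.1)))) →
      ∀ k₁ k₃ k₂ : ℝ,
        (S₁ (k₁, k₃, k₂) = 0 → A (k₁, k₃, k₂) = 0 → fderiv ℝ A (k₁, k₃, k₂) (0, 0, 1) ≠ 0) ∧
        (S₂ (k₁, k₃, k₂) = 0 → A (k₁, k₃, k₂) = 0 → fderiv ℝ A (k₁, k₃, k₂) (1, 0, 0) ≠ 0) ∧
        (S₁ (k₁, k₃, k₂) = 0 → S₂ (k₁, k₃, k₂) = 0 → A (k₁, k₃, k₂) = 0 →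
          fderiv ℝ A (k₁, k₃, k₂) (1, 0, 0) + fderiv ℝ A (k₁, k₃, k₂) (0, 1, 0) +
            fderiv ℝ A (k₁, k₃, k₂) (0, 0, 1) ≠ 0) :=
  fun _ hω _ _ _ hS₁ hS₂ hA k₁ k₃ k₂ =>
    ⟨sheet_transversal₁ hω hS₁ hA k₁ k₃ k₂, sheet_transversal₂ hω hS₂ hA k₁ k₃ k₂,
      sheet_transversal_diag hω hS₁ hS₂ hA k₁ k₃ k₂⟩

end Summit.AtomisticToContinuum.FouriersLaw.Theorems.DrudeDissolution.KineticPolymerGasOnTheTimeAxis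

end
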